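import Mathlib
import Summits.NavierStokesRegularity.NavierStokesRegularity.Theorems.ScenarioCensusPeriodicSlabWindow
import Literature.Analysis.FluidPDE.SteadyNSLocalEnergy
import HarnessLib

/-!
# Census row S6 (bounded helical steady flows): the localised energy identity of the steady
# Navier–Stokes system per period (nonlinear window identity)

Support file for the scenario census of `NavierStokesRegularity` (cell `pub/ns-census`, block S,
row S6 = Han–Wang–Xie, arXiv:2312.10382, Thm 1.1; tree FACT
`Literature.Analysis.FluidPDE.HanWangXie2023_helical_liouville`). Display (3.2) of the printed
proof ("Multiplying the first equation in (1.1) by `φ_R(r) u` and integrating by parts over the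
slab `Ω = ℝ² × (0,1)`, one obtains
`∫_Ω |∇u|² φ_R = −∫_Ω ∇φ_R · ∇u · u + ∫_Ω ½|u|² u · ∇φ_R + ∫_Ω P u · ∇φ_R`", valid because
the pressure is periodic, Lemma 2.7) in the tree's period-slab vocabulary:

* `steady_window_identity` — for a smooth steady solution `(U, P)` at unit viscosity
  (`IsLerayProfile 1 0 U P`) with `U` AND `P` axially `L`-periodic and an axially periodic `C²`
  cut-off `φ ≥ 0` vanishing off a cylinder (`S = zSlab L 0` one period, `eᵢ` the standard basis):
  `∫_S φ |DU|² = −Σᵢ ∫_S (∂ᵢφ) ⟪∂ᵢU, U⟫ + ½ ∫_S (Dφ·U) ‖U‖² + ∫_S P (Dφ·U)`.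

Ingredients: the tree's whole-space localised energy identity
`Literature.Analysis.FluidPDE.IsLerayProfile.integral_mul_frobeniusNormSq_eq` (second-order form
`½∫(ΔΦ)|U|²`) tested with `Φ = φ ω_L²`, Green's identity for `(Φ, |U|²)` to return to the
first-order form, and the window bookkeeping of `…PeriodicSlabWindow` (terms in which the
derivative falls on the window are integrals of periodic densities against `(ω²)'` and vanish —
this is where the periodicity of `P` enters).

No summit statement and no census row is proved in this file.

## References

* J. Han, Y. Wang, C. Xie, arXiv:2312.10382 (2023), §3, (3.2) = (muinteeq). [HanWangXie2023]
* G. Seregin, W. Wang, St. Petersburg Math. J. 31 (2020), proof of Prop. 2.1. [SereginWang2020]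
-/

-- the summit and its single problem share the name (D-0017 nested layout)
set_option linter.dupNamespace false

noncomputable section

open MeasureTheory Set Function Filter InnerProductSpace
open scoped Topology ENNReal NNReal RealInnerProductSpace Laplacian ContDiff

namespace Summit.NavierStokesRegularity.NavierStokesRegularity.Theorems.ScenarioCensus.HelicalSlab

open Literature.Analysis Literature.Analysis.FluidPDE
open Summit.NavierStokesRegularity.NavierStokesRegularity.Theorems.ScenarioCensus.PeriodicSlab

/-- **The localised energy identity of the steady system, first-order form** (whole space). For
`IsLerayProfile 1 0 U P` and `Φ ∈ C²_c`:
`∫ Φ |DU|² = −Σᵢ ∫ (∂ᵢΦ) ⟪∂ᵢU, U⟫ + ½ ∫ (DΦ·U) ‖U‖² + ∫ P (DΦ·U)` — the tree identity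
`IsLerayProfile.integral_mul_frobeniusNormSq_eq` with its Green term `½∫(ΔΦ)‖U‖²` integrated by
parts once more. -/
theorem steady_energy_identity_firstOrder {ι : Type*} [Fintype ι]
    (b : OrthonormalBasis ι ℝ (EuclideanSpace ℝ (Fin 3)))
    {U : EuclideanSpace ℝ (Fin 3) → EuclideanSpace ℝ (Fin 3)} {P : EuclideanSpace ℝ (Fin 3) → ℝ}
    (h : IsLerayProfile 1 0 U P) {Φ : EuclideanSpace ℝ (Fin 3) → ℝ} (hΦ : ContDiff ℝ 2 Φ)
    (hΦc : HasCompactSupport Φ) :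
    ∫ x, Φ x * frobeniusNormSq (fderiv ℝ U x) =
      -(∑ i, ∫ x, fderiv ℝ Φ x (b i) * ⟪fderiv ℝ U x (b i), U x⟫) +
        2⁻¹ * (∫ x, fderiv ℝ Φ x (U x) * ‖U x‖ ^ 2) + ∫ x, P x * fderiv ℝ Φ x (U x) := by
  have hid := h.integral_mul_frobeniusNormSq_eq hΦ hΦc
  -- Green's identity for `v = Φ`, `w = ‖U‖²`
  have hU2 : ContDiff ℝ 2 U := h.contDiff_velocity
  have hU1 : ContDiff ℝ 1 U := hU2.of_le one_le_two
  have hUd : ∀ x, DifferentiableAt ℝ U x := fun x => hU1.differentiable one_ne_zero x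
  set g : EuclideanSpace ℝ (Fin 3) → ℝ := fun x => ‖U x‖ ^ 2 with hg
  have hg_inner : g = fun x => ⟪U x, U x⟫ := funext fun x => by rw [hg, real_inner_self_eq_norm_sq]
  have hg1 : ContDiff ℝ 1 g := by rw [hg_inner]; exact hU1.inner ℝ hU1
  have hDg : ∀ x v, fderiv ℝ g x v = 2 * ⟪fderiv ℝ U x v, U x⟫ := fun x v => by
    rw [hg_inner, fderiv_inner_apply ℝ (hUd x) (hUd x) v, real_inner_comm]
    ring
  have green := FluidPDE.integral_inner_laplacian_add_eq_zero b (F' := ℝ) hΦ hg1 (Or.inl hΦc)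
  have e1 : ∫ x, ⟪(Δ Φ) x, g x⟫ = ∫ x, (Δ Φ) x * ‖U x‖ ^ 2 :=
    integral_congr_ae (Eventually.of_forall fun x => by
      simp only [hg, RCLike.inner_apply, conj_trivial, mul_comm])
  have e2 : ∀ i, ∫ x, ⟪fderiv ℝ Φ x (b i), fderiv ℝ g x (b i)⟫ =
      2 * ∫ x, fderiv ℝ Φ x (b i) * ⟪fderiv ℝ U x (b i), U x⟫ := fun i => by
    rw [← integral_const_mul]
    refine integral_congr_ae (Eventually.of_forall fun x => ?_)
    simp only [RCLike.inner_apply, conj_trivial, hDg]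
    ring
  rw [e1] at green
  simp_rw [e2] at green
  rw [← Finset.mul_sum] at green
  rw [hid]
  linarith

/-- **The localised energy identity per period** (Han–Wang–Xie, §3, (3.2)). Let `(U, P)` be a
smooth steady solution at unit viscosity (`IsLerayProfile 1 0 U P`, `U, P ∈ C^∞`) with `U` and
`P` axially `L`-periodic (`L > 0`), and let `φ ≥ 0` be an axially periodic `C²` cut-off vanishing
off a cylinder. Then, with `S = zSlab L 0` and `eᵢ` the standard basis,
`∫_S φ |DU|² = −Σᵢ ∫_S (∂ᵢφ)⟪∂ᵢU, U⟫ + ½ ∫_S (Dφ·U)‖U‖² + ∫_S P (Dφ·U)`. -/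
theorem steady_window_identity {L : ℝ} (hL : 0 < L)
    {U : EuclideanSpace ℝ (Fin 3) → EuclideanSpace ℝ (Fin 3)} {P : EuclideanSpace ℝ (Fin 3) → ℝ}
    (h : IsLerayProfile 1 0 U P) (hU : ContDiff ℝ (⊤ : ℕ∞) U) (hP : ContDiff ℝ (⊤ : ℕ∞) P)
    (hUper : IsAxiallyPeriodic L U) (hPper : IsAxiallyPeriodic L P)
    {φ : EuclideanSpace ℝ (Fin 3) → ℝ} (hφ : ContDiff ℝ 2 φ) (hφper : IsAxiallyPeriodic L φ)
    (hφnn : ∀ x, 0 ≤ φ x) {ρ : ℝ} (hφ0 : ∀ x, ρ ≤ cylRadius x → φ x = 0) :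
    ∫ x in zSlab L 0, φ x * frobeniusNormSq (fderiv ℝ U x) =
      -(∑ i, ∫ x in zSlab L 0, fderiv ℝ φ x (EuclideanSpace.basisFun (Fin 3) ℝ i) *
          ⟪fderiv ℝ U x (EuclideanSpace.basisFun (Fin 3) ℝ i), U x⟫) +
        2⁻¹ * (∫ x in zSlab L 0, fderiv ℝ φ x (U x) * ‖U x‖ ^ 2) +
        ∫ x in zSlab L 0, P x * fderiv ℝ φ x (U x) := by
  set b := EuclideanSpace.basisFun (Fin 3) ℝ with hb
  set ω2 : ℝ → ℝ := fun s => periodicWindow L s ^ 2 with hω2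
  set Φ : EuclideanSpace ℝ (Fin 3) → ℝ := fun x => φ x * ω2 (x 2) with hΦ
  -- regularity and support
  have hφ1 : ContDiff ℝ 1 φ := hφ.of_le one_le_two
  have hU1 : ContDiff ℝ 1 U := contDiff_infty.1 hU 1
  have hUc : Continuous U := hU1.continuous
  have hPc : Continuous P := hP.continuous
  have hφc : Continuous φ := hφ.continuous
  have hDUc : Continuous (fderiv ℝ U) := hU1.continuous_fderiv one_ne_zero
  have hDφc : Continuous (fderiv ℝ φ) := hφ1.continuous_fderiv one_ne_zero
  have hω2 : ContDiff ℝ 2 ω2 := contDiff_periodicWindow_sq L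
  have hω21 : ContDiff ℝ 1 ω2 := contDiff_periodicWindow_sq L
  have hΦ2 : ContDiff ℝ 2 Φ := contDiff_mul_comp_apply_two hφ hω2
  have hΦc : HasCompactSupport Φ :=
    hasCompactSupport_mul_comp_apply_two hφ0 (abs_le_of_periodicWindow_sq_ne_zero hL)
  have hφD0 : ∀ x, ρ ≤ cylRadius x → fderiv ℝ φ x = 0 := fun x hx => by
    have hmin : IsLocalMin φ x := Eventually.of_forall fun y => by rw [hφ0 x hx]; exact hφnn y
    exact hmin.fderiv_eq_zero
  have hDΦ : ∀ (x v : EuclideanSpace ℝ (Fin 3)),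
      fderiv ℝ Φ x v = ω2 (x 2) * fderiv ℝ φ x v + φ x * deriv ω2 (x 2) * v 2 := fun x v =>
    fderiv_mul_comp_apply_two (hφ1.differentiable one_ne_zero x) (hω21.differentiable one_ne_zero _) v
  have hDUper : IsAxiallyPeriodic L (fderiv ℝ U) := isAxiallyPeriodic_fderiv hUper
  have hDφper : IsAxiallyPeriodic L (fderiv ℝ φ) := isAxiallyPeriodic_fderiv hφper
  -- the whole-space identity
  have id := steady_energy_identity_firstOrder b h hΦ2 hΦc
  -- (0) `φ |DU|²`
  have hFc : Continuous fun x => frobeniusNormSq (fderiv ℝ U x) :=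
    continuous_frobeniusNormSq_fderiv hU1 one_ne_zero
  have e0 : ∫ x, Φ x * frobeniusNormSq (fderiv ℝ U x) =
      ∫ x in zSlab L 0, φ x * frobeniusNormSq (fderiv ℝ U x) := by
    obtain ⟨c0, -, -, -⟩ := window_bookkeeping hL (Q := fun x => φ x * frobeniusNormSq (fderiv ℝ U x))
      (hφc.mul hFc) (fun x => by simp only [hφper x, hDUper x]) (ρ := ρ)
      (fun x hx => by rw [hφ0 x hx, zero_mul])
    rw [← c0]; refine integral_congr_ae (Eventually.of_forall fun x => ?_)
    simp only [hΦ]; ring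
  -- (1) `∂ᵢΦ ⟪∂ᵢU, U⟫`
  have e1 : ∀ i, ∫ x, fderiv ℝ Φ x (b i) * ⟪fderiv ℝ U x (b i), U x⟫ =
      ∫ x in zSlab L 0, fderiv ℝ φ x (b i) * ⟪fderiv ℝ U x (b i), U x⟫ := by
    intro i
    obtain ⟨cA, -, iA, -⟩ := window_bookkeeping hL
      (Q := fun x => fderiv ℝ φ x (b i) * ⟪fderiv ℝ U x (b i), U x⟫)
      ((hDφc.clm_apply continuous_const).mul ((hDUc.clm_apply continuous_const).inner hUc))
      (fun x => by simp only [hDφper x, hDUper x, hUper x]) (ρ := ρ)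
      (fun x hx => by rw [hφD0 x hx]; simp)
    obtain ⟨-, cB, -, iB⟩ := window_bookkeeping hL
      (Q := fun x => φ x * (b i) 2 * ⟪fderiv ℝ U x (b i), U x⟫)
      ((hφc.mul continuous_const).mul ((hDUc.clm_apply continuous_const).inner hUc))
      (fun x => by simp only [hφper x, hDUper x, hUper x]) (ρ := ρ)
      (fun x hx => by rw [hφ0 x hx]; simp)
    rw [← cA, ← add_zero (∫ x, fderiv ℝ φ x (b i) * _ * _), ← cB, ← integral_add iA iB]
    refine integral_congr_ae (Eventually.of_forall fun x => ?_)
    simp only [hDΦ]; ring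
  -- (2) `DΦ·U ‖U‖²`
  have e2 : ∫ x, fderiv ℝ Φ x (U x) * ‖U x‖ ^ 2 =
      ∫ x in zSlab L 0, fderiv ℝ φ x (U x) * ‖U x‖ ^ 2 := by
    obtain ⟨cA, -, iA, -⟩ := window_bookkeeping hL
      (Q := fun x => fderiv ℝ φ x (U x) * ‖U x‖ ^ 2)
      ((hDφc.clm_apply hUc).mul (hUc.norm.pow 2))
      (fun x => by simp only [hDφper x, hUper x]) (ρ := ρ)
      (fun x hx => by rw [hφD0 x hx]; simp)
    obtain ⟨-, cB, -, iB⟩ := window_bookkeeping hL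
      (Q := fun x => φ x * (U x) 2 * ‖U x‖ ^ 2)
      ((hφc.mul ((continuous_apply 2).comp ((PiLp.continuous_ofLp 2 _).comp hUc))).mul
        (hUc.norm.pow 2))
      (fun x => by simp only [hφper x, hUper x]) (ρ := ρ)
      (fun x hx => by rw [hφ0 x hx]; simp)
    rw [← cA, ← add_zero (∫ x, fderiv ℝ φ x (U x) * _ * _), ← cB, ← integral_add iA iB]
    refine integral_congr_ae (Eventually.of_forall fun x => ?_)
    simp only [hDΦ]; ring
  -- (3) `P DΦ·U` (here the periodicity of the pressure is used)
  have e3 : ∫ x, P x * fderiv ℝ Φ x (U x) = ∫ x in zSlab L 0, P x * fderiv ℝ φ x (U x) := by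
    obtain ⟨cA, -, iA, -⟩ := window_bookkeeping hL
      (Q := fun x => P x * fderiv ℝ φ x (U x))
      (hPc.mul (hDφc.clm_apply hUc))
      (fun x => by simp only [hDφper x, hPper x, hUper x]) (ρ := ρ)
      (fun x hx => by rw [hφD0 x hx]; simp)
    obtain ⟨-, cB, -, iB⟩ := window_bookkeeping hL
      (Q := fun x => P x * φ x * (U x) 2)
      ((hPc.mul hφc).mul ((continuous_apply 2).comp ((PiLp.continuous_ofLp 2 _).comp hUc)))
      (fun x => by simp only [hφper x, hPper x, hUper x]) (ρ := ρ)
      (fun x hx => by rw [hφ0 x hx]; simp)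
    rw [← cA, ← add_zero (∫ x, P x * _ * _), ← cB, ← integral_add iA iB]
    refine integral_congr_ae (Eventually.of_forall fun x => ?_)
    simp only [hDΦ]; ring
  rw [e0, e2, e3] at id
  simp_rw [e1] at id
  exact id

end Summit.NavierStokesRegularity.NavierStokesRegularity.Theorems.ScenarioCensus.HelicalSlab

end
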